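import Mathlib
import Literature.Computability.AlgebraicComplexity.GroupTheoreticMatMul
import Summits.MatrixMultiplication.OmegaCensus.STPPDisjointPacking
import Summits.MatrixMultiplication.MatrixMultiplication.Theorems.GroupTheoreticSTPPCThesisNoFour444Order124

/-!
# No four `(4,4,4)` STPP triples in an abelian group of order `127` (T_E residual Q3.12 at the prime)

Support file for route `MatrixMultiplication/GroupTheoreticSTPP`, crux `stmt-MatrixMultiplication-0597`,
cell `mm-stpp` (D-0046), CENSUS-PLAN §6.1 Q3.12; memo `HOME/mm-stpp-eng-2/TE-RESIDUALS.md` §2 (mm-stpp-eng-2).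
Continues `GroupTheoreticSTPPCThesisNoFour444Order124.lean` (representation counts `r(x)`).

* `card_filter_add_mem_superadd` — subadditivity of the translation defect, stated for the count
  `g(t) = #{e ∈ E : e + t ∈ E}`: `g(s) + g(t) ≤ g(s + t) + |E|`;
* `sum_card_filter_add_mem` — the energy identity `Σ_t g(t) = |E|²`;
* `rep_add_rep_le` — the near-period lemma `r(x) + r(x') ≤ g(x' − x) + |F|`;
* `cauchy_davenport_127` — Mathlib's `cauchy_davenport_minOrder_add` specialised to groups of order `127`;
* `no_isSTPP_444x4_order127` — **no `IsSTPP` family of four `(4,4,4)` triples in an abelian group of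
  order `127`**: the `63` points outside `−D` carry `Σ r = 3840`, so `≥ 31` of them have `r ≥ 59`; their
  difference set `S` (`≥ 61` elements, Cauchy–Davenport) has `g ≥ 54`, `S + S` (`≥ 121` elements) has
  `g ≥ 44`, and `44 · 121 > 64² = Σ_t g(t)`.

WHAT THIS IS NOT: no `ω` statement; one residual multiset of the abelian T_E census at one order.
-/

-- single-conjunct summit: the mandated namespace repeats `MatrixMultiplication`.
set_option linter.dupNamespace false

namespace Summit.MatrixMultiplication.MatrixMultiplication.Theorems

namespace STPPEnergy

open Finset Literature.Computability.AlgebraicComplexity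
open scoped Pointwise

variable {H : Type*} [AddCommGroup H] [Fintype H] [DecidableEq H] {N : ℕ} {A B C : Fin N → Finset H}

/-! ### Near-periods and the order-`127` case (T_E residual Q3.12) -/

omit [Fintype H] in
/-- The translation count `g(t) = #{e ∈ E : e + t ∈ E} = |E ∩ (E − t)|` is at most `|E|`. [folklore] -/
theorem card_filter_add_mem_le (E : Finset H) (t : H) :
    (E.filter fun e => e + t ∈ E).card ≤ E.card := card_filter_le _ _

/-- `Σ_t #{e ∈ E : e + t ∈ E} = |E|²` (count ordered pairs of `E`). [folklore] -/
theorem sum_card_filter_add_mem (E : Finset H) :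
    ∑ t, (E.filter fun e => e + t ∈ E).card = E.card * E.card := by
  simp_rw [card_filter]
  rw [sum_comm]
  have : ∀ e ∈ E, (∑ t, if e + t ∈ E then 1 else 0) = E.card := by
    intro e _
    rw [← card_filter]
    refine card_bij (fun t _ => e + t) (fun t ht => (mem_filter.1 ht).2) (fun t₁ _ t₂ _ h12 => ?_)
      (fun f hf => ⟨f - e, by simp [hf], by simp⟩)
    simpa using h12
  rw [sum_congr rfl this, sum_const, smul_eq_mul]

omit [Fintype H] in
/-- **Subadditivity** of the translation count: `g(s) + g(t) ≤ g(s + t) + |E|`. [folklore] -/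
theorem card_filter_add_mem_superadd (E : Finset H) (s t : H) :
    (E.filter fun e => e + s ∈ E).card + (E.filter fun e => e + t ∈ E).card
      ≤ (E.filter fun e => e + (s + t) ∈ E).card + E.card := by
  -- inject `{e ∈ E : e + s ∈ E}` into `E` by `e ↦ e + s`; its image meets `{e' ∈ E : e' + t ∈ E}` in
  -- at least `g(s) + g(t) − |E|` points, whose preimages lie in `{e : e + (s+t) ∈ E}`
  set Gs := E.filter fun e => e + s ∈ E
  set Gt := E.filter fun e => e + t ∈ E
  set Gst := E.filter fun e => e + (s + t) ∈ E
  have hI : (Gs.image fun e => e + s) ⊆ E := by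
    intro y hy; rw [mem_image] at hy; obtain ⟨e, he, rfl⟩ := hy; exact (mem_filter.1 he).2
  have hIc : (Gs.image fun e => e + s).card = Gs.card :=
    card_image_of_injective _ fun a b hab => by simpa using hab
  have hmeet : ((Gs.image fun e => e + s) ∩ Gt).card ≤ Gst.card := by
    refine card_le_card_of_injOn (fun y => y - s) (fun y hy => ?_) (fun a _ b _ hab => by simpa using hab)
    rw [coe_inter, Set.mem_inter_iff, mem_coe, mem_coe, mem_image] at hy
    obtain ⟨⟨e, he, rfl⟩, hy2⟩ := hy
    rw [mem_coe, mem_filter]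
    refine ⟨by simpa using (mem_filter.1 he).1, ?_⟩
    have : e + s - s + (s + t) = e + s + t := by abel
    rw [this]; exact (mem_filter.1 hy2).2
  have hunion : ((Gs.image fun e => e + s) ∪ Gt).card ≤ E.card :=
    card_le_card (union_subset hI (filter_subset _ _))
  have := card_union_add_card_inter (Gs.image fun e => e + s) Gt
  omega

omit [Fintype H] in
/-- **Near-period lemma.** With `r(x) = #{e ∈ E : x − e ∈ F}`:
`r(x) + r(x') ≤ #{e ∈ E : e + (x' − x) ∈ E} + |F|`. [original] -/
theorem rep_add_rep_le (E F : Finset H) (x x' : H) :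
    (E.filter fun e => x - e ∈ F).card + (E.filter fun e => x' - e ∈ F).card
      ≤ (E.filter fun e => e + (x' - x) ∈ E).card + F.card := by
  -- both representation sets, read inside `F`
  set Sx := F.filter fun f => x - f ∈ E
  set Sx' := F.filter fun f => x' - f ∈ E
  have hSx : (E.filter fun e => x - e ∈ F).card = Sx.card := by
    refine card_bij (fun e _ => x - e) (fun e he => ?_) (fun a _ b _ hab => by simpa using hab)
      (fun f hf => ⟨x - f, ?_, by simp⟩)
    · rw [mem_filter] at he ⊢; exact ⟨he.2, by simpa using he.1⟩
    · rw [mem_filter] at hf ⊢; exact ⟨hf.2, by simpa using hf.1⟩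
  have hSx' : (E.filter fun e => x' - e ∈ F).card = Sx'.card := by
    refine card_bij (fun e _ => x' - e) (fun e he => ?_) (fun a _ b _ hab => by simpa using hab)
      (fun f hf => ⟨x' - f, ?_, by simp⟩)
    · rw [mem_filter] at he ⊢; exact ⟨he.2, by simpa using he.1⟩
    · rw [mem_filter] at hf ⊢; exact ⟨hf.2, by simpa using hf.1⟩
  have hmeet : (Sx ∩ Sx').card ≤ (E.filter fun e => e + (x' - x) ∈ E).card := by
    refine card_le_card_of_injOn (fun f => x - f) (fun f hf => ?_) (fun a _ b _ hab => by simpa using hab)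
    rw [coe_inter, Set.mem_inter_iff, mem_coe, mem_coe, mem_filter, mem_filter] at hf
    rw [mem_coe, mem_filter]
    refine ⟨hf.1.2, ?_⟩
    have : x - f + (x' - x) = x' - f := by abel
    rw [this]; exact hf.2.2
  have hunion : (Sx ∪ Sx').card ≤ F.card := card_le_card (union_subset (filter_subset _ _) (filter_subset _ _))
  have := card_union_add_card_inter Sx Sx'
  omega

/-- Cauchy–Davenport in an abelian group of prime order `127`: `min(127, |S| + |T| − 1) ≤ |S + T|`
(every non-zero element has order `127`, so Mathlib's `cauchy_davenport_minOrder_add` applies with `minOrder = 127`). [folklore] -/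
theorem cauchy_davenport_127 (hH : Fintype.card H = 127) {S T : Finset H} (hS : S.Nonempty)
    (hT : T.Nonempty) : min 127 (S.card + T.card - 1) ≤ (S + T).card := by
  have hmin : ((127 : ℕ) : ℕ∞) ≤ AddMonoid.minOrder H := by
    rw [AddMonoid.le_minOrder]
    intro a ha _
    have hd : addOrderOf a ∣ 127 := by rw [← hH]; exact addOrderOf_dvd_card
    rcases (Nat.dvd_prime (by norm_num : Nat.Prime 127)).1 hd with h1 | h127
    · exact absurd (AddMonoid.addOrderOf_eq_one_iff.1 h1) ha
    · exact_mod_cast h127.ge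
  have hcd := cauchy_davenport_minOrder_add hS hT
  have : min ((127 : ℕ) : ℕ∞) ((S.card + T.card - 1 : ℕ) : ℕ∞) ≤ ((S + T).card : ℕ∞) :=
    (min_le_min_right _ hmin).trans hcd
  rcases min_le_iff.1 this with h1 | h2
  · exact min_le_of_left_le (by exact_mod_cast h1)
  · exact min_le_of_right_le (by exact_mod_cast h2)

/-- **No `IsSTPP` family of four `(4,4,4)` triples in an abelian group of order `127`** (T_E residual
Q3.12 at the prime `127`): near-periods of `E`, two rounds of Cauchy–Davenport, and the energy count
`Σ_t g(t) = 64²`. [original] -/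
theorem no_isSTPP_444x4_order127 (hH : Fintype.card H = 127) (A B C : Fin 4 → Finset H)
    (hA : ∀ i, (A i).card = 4) (hB : ∀ i, (B i).card = 4) (hC : ∀ i, (C i).card = 4) :
    ¬ IsSTPP A B C := by
  intro h
  have hAne : ∀ i, (A i).Nonempty := fun i => card_pos.1 (by rw [hA i]; norm_num)
  have hBne : ∀ i, (B i).Nonempty := fun i => card_pos.1 (by rw [hB i]; norm_num)
  have hCne : ∀ i, (C i).Nonempty := fun i => card_pos.1 (by rw [hC i]; norm_num)
  set D := univ.biUnion fun t => A t - B t with hDdef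
  set E := univ.biUnion fun t => B t - C t with hEdef
  set F := univ.biUnion fun t => C t - A t with hFdef
  have hDc : D.card = 64 := by
    rw [hDdef, card_biUnion_sub h hCne]; simp [hA, hB]
  have hEc : E.card = 64 := by
    rw [hEdef, card_biUnion_sub (OmegaCensus.stpp_rotate h) hAne]; simp [hB, hC]
  have hFc : F.card = 64 := by
    rw [hFdef, card_biUnion_sub (OmegaCensus.stpp_rotate (OmegaCensus.stpp_rotate h)) hBne]; simp [hC, hA]
  set X := univ \ D.image Neg.neg with hXdef
  have hDimg : (D.image Neg.neg).card = 64 := by rw [card_image_of_injective _ neg_injective, hDc]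
  have hXc : X.card = 63 := by
    rw [hXdef, card_sdiff_of_subset (subset_univ _), card_univ, hH, hDimg]
  set r : H → ℕ := fun x => (E.filter fun e => x - e ∈ F).card with hrdef
  have hsum : ∑ x ∈ X, r x = 3840 := by
    have := sum_rep_compl h hCne
    simp only [hA, hB, hC, Fin.sum_univ_four] at this
    rw [← hDdef, ← hEdef, ← hFdef, hEc, hFc, ← hXdef] at this
    simp only [hrdef]
    omega
  have hle : ∀ x, r x ≤ 64 := fun x => (card_filter_rep_le E F x).trans hFc.le
  -- Y := points of X with r ≥ 59 ; |Y| ≥ 31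
  set Y := X.filter fun x => 59 ≤ r x with hYdef
  have hYc : 31 ≤ Y.card := by
    have hsplit := sum_filter_add_sum_filter_not X (fun x => 59 ≤ r x) r
    have h1 : ∑ x ∈ Y, r x ≤ 64 * Y.card := by
      rw [mul_comm, ← smul_eq_mul, ← sum_const]
      exact sum_le_sum fun x _ => hle x
    have h2 : ∑ x ∈ X.filter (fun x => ¬ 59 ≤ r x), r x ≤ 58 * (X.filter fun x => ¬ 59 ≤ r x).card := by
      rw [mul_comm, ← smul_eq_mul, ← sum_const]
      exact sum_le_sum fun x hx => by have := (mem_filter.1 hx).2; omega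
    have h3 := card_filter_add_card_filter_not (s := X) (fun x => 59 ≤ r x)
    rw [hXc, ← hYdef] at h3
    rw [← hYdef, hsum] at hsplit
    omega
  have hYne : Y.Nonempty := card_pos.1 (by omega)
  -- g(t) := #{e ∈ E : e + t ∈ E}; on Y − Y it is ≥ 54
  set g : H → ℕ := fun t => (E.filter fun e => e + t ∈ E).card with hgdef
  have hgS : ∀ d ∈ Y - Y, 54 ≤ g d := by
    intro d hd
    rw [mem_sub] at hd
    obtain ⟨y, hy, y', hy', rfl⟩ := hd
    have h1 := rep_add_rep_le E F y' y
    have hy1 := (mem_filter.1 hy).2; have hy2 := (mem_filter.1 hy').2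
    simp only [hrdef] at hy1 hy2
    rw [hFc] at h1
    simp only [hgdef]
    omega
  -- |Y − Y| ≥ 61
  have hSc : 61 ≤ (Y - Y).card := by
    have := cauchy_davenport_127 hH hYne (hYne.neg)
    rw [← sub_eq_add_neg, card_neg] at this
    omega
  -- on (Y − Y) + (Y − Y) the count is ≥ 44, and that set has ≥ 121 elements
  have hgT : ∀ d ∈ (Y - Y) + (Y - Y), 44 ≤ g d := by
    intro d hd
    rw [mem_add] at hd
    obtain ⟨d₁, hd₁, d₂, hd₂, rfl⟩ := hd
    have := card_filter_add_mem_superadd E d₁ d₂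
    have h1 := hgS d₁ hd₁; have h2 := hgS d₂ hd₂
    simp only [hgdef] at h1 h2 ⊢
    rw [hEc] at this
    omega
  have hSne : (Y - Y).Nonempty := hYne.sub hYne
  have hTc : 121 ≤ ((Y - Y) + (Y - Y)).card := by
    have := cauchy_davenport_127 hH hSne hSne
    omega
  -- energy count
  have htot : ∑ t, g t = 4096 := by
    simp only [hgdef]; rw [sum_card_filter_add_mem, hEc]
  have hT : 44 * ((Y - Y) + (Y - Y)).card ≤ ∑ t ∈ (Y - Y) + (Y - Y), g t := by
    rw [mul_comm, ← smul_eq_mul, ← sum_const]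
    exact sum_le_sum hgT
  have hsub : ∑ t ∈ (Y - Y) + (Y - Y), g t ≤ ∑ t, g t :=
    sum_le_sum_of_subset_of_nonneg (subset_univ _) fun _ _ _ => Nat.zero_le _
  omega

end STPPEnergy

end Summit.MatrixMultiplication.MatrixMultiplication.Theorems
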